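import Summits.QuantumFields.BalabanUV.T4Continuum.Support.NE3EnergyMix
import Summits.QuantumFields.BalabanUV.T4Continuum.Support.NE7OneStepOfPathOpen
import Summits.QuantumFields.BalabanUV.T4Continuum.Support.NE3EnergyHessTwoTerm
import HarnessLib

/-!
# NE7ExpansionStructure — THE STRUCTURE HALF OF THE EXPANSION LETTER (EXP) OF F38's BUNDLE: the first variation at `V e^{A}` minus the Hessian at
# `V` is controlled by the VARIATION OF THE HESSIAN ALONG THE SEGMENT `s ↦ V e^{sA}`; at a FLAT `V` the first variation at `V` itself drops out,
# and the traceless `dcurlAt` part of the Hessian's variation only sees the plaquette deviation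

Cell `pub-balaban`, rung (B)+1 sub-cell t4, lineage `b2b-balaban-t4-ne7-p1`, generation 70 (CRUX PROVER NE7 #1); memo
`t4/b2b-balaban-t4-ne7-p1-g70/HUNT-H14-APE-FLAT-SKELETON.md` §1 FACT 2, §5 (5).  File F45 (over row NE3's `NE3HessForm.hasDerivAt_dAction_vary_at₂`,
`NE3EnergyMix.abs_sub_le_of_abs_deriv_le`, `NE3EnergyHessTwoTerm.nReTr_dcurlAt`, gen 67's F20 `NE7OneStepOfPathOpen.dAction_eq_zero_of_flat`).
WHY.  F38's expansion letter asks `|dAction (F̃e^{A}) Y − hess F̃ A Y| ≤ ρ‖Y‖_ℓ¹` with `ρ ≲ M⁻³`.  THIS FILE isolates what has to be estimated: by the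
mean-value inequality along `s ↦ F̃e^{sA}` (whose `s`-derivative of `dAction · Y` IS `hess (F̃e^{sA}) A Y`), the letter follows from a UNIFORM bound on
`hess (F̃e^{sA}) A Y − hess F̃ A Y`, `s ∈ [0,1]` (§1); and per plaquette that difference splits (§2) into the `dcurlAt` channel — which, BEING TRACELESS
at every background, only sees the plaquette deviation `‖F̃e^{sA}(∂p′) − 1‖` (no bare `α₀²` term) — and the curl-curl channel
`Re tr[(d_s Y)(d_s A)·hol_s] − Re tr[(d_0 Y)(d_0 A)]`, whose only piece beyond the reach of the Lipschitz letters with the a-priori curl bound is the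
cubic vertex `⟨d_{F̃}Y, 𝒬(A)⟩` (`𝒬` = the commutator part of the non-abelian curvature) — the term the successor moves onto `Y` by parts with the
gradient currency (memo §1 FACT 2).
WHAT ([folklore]; 0 def, 0 sorry).  §1 **`abs_dAction_vary_sub_hess_le`** (`|dAction (Ve^{A}) Y W − dAction V Y W − hess V A Y W| ≤ C` from
`∀ s ∈ [0,1], |hess (Ve^{sA}) A Y W − hess V A Y W| ≤ C`), **`abs_dAction_vary_sub_hess_le_flat`** (at a flat unitary `V` and skew `Y`: `dAction V Y W = 0`
drops).  §2 **`hessPlaqAt_sub_hessPlaqAt_eq`** (the two-channel split with the traceless channel reduced to `−Re tr[dcurlAt_s·(hol_s − 1)] + Re tr[dcurlAt_0·(hol_0 − 1)]`),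
`hessPlaqAt_sub_flat_eq` (at a flat `V`: `hol_0 = 1`).
HONEST FRAMING (page 1): calculus bookkeeping; the strong remainder (the by-parts of the cubic vertex) is NOT here; nothing of Bałaban's asserted; NOT (APE),
NOT ONE-STEP, NOT NE7; spine 0∕9; finite T⁴ rung (B)+1 — NOT infinite volume, NOT mass gap, NOT Clay.  Continuum YM on T⁴ ⇐ BetaPertH ∧ nine spine estimates
(0/9 proved); BetaPertH ⇐ (D1) ∧ (D4) ∧ CAP+tail; G-an2-4 gates asym, D1 and NE2/3/4.
-/

set_option autoImplicit false

open scoped BigOperators Matrix.Norms.L2Operator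
open NormedSpace Finset Set

namespace Summit.QuantumFields.BalabanUV.T4Continuum.NE7ExpansionStructure

open Literature.MathematicalPhysics.QuantumFieldTheory.Balaban1983to89
open B7Prop1Explicit B7Prop2Explicit MatrixLog UnitaryModel
open T4AveragingDeficitWall (IsUnitaryCfg IsSkewDir SmallField vary curlAt vary_zero)
open NE3HessForm (hess hessPlaqAt dcurlAt dAction hasDerivAt_dAction_vary_at₂)
open NE3EnergyMix (abs_sub_le_of_abs_deriv_le)
open NE3EnergyHessTwoTerm (nReTr_dcurlAt)
open NE7OneStepOfPathOpen (dAction_eq_zero_of_flat)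

noncomputable section

variable {d : ℕ} {n : Type*} [Fintype n] [DecidableEq n]

/-! ## §1 The expansion letter from a uniform bound on the Hessian's variation along the segment -/

/-- **`|dAction (Ve^{A}) Y W − dAction V Y W − hess V A Y W| ≤ C`** whenever `|hess (Ve^{sA}) A Y W − hess V A Y W| ≤ C` for all `s ∈ [0,1]`
(mean-value inequality for `s ↦ dAction (Ve^{sA}) Y W − s·hess V A Y W`, derivative `hess (Ve^{sA}) A Y W − hess V A Y W` by
`hasDerivAt_dAction_vary_at₂`). [folklore] -/
theorem abs_dAction_vary_sub_hess_le (V : Site d → Fin d → (Matrix n n ℂ)ˣ) (A Y : Site d → Fin d → Matrix n n ℂ)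
    (W : Finset (T4AveragingDeficitWall.Plaq d)) {C : ℝ}
    (hC : ∀ s ∈ Icc (0:ℝ) 1, |hess (vary V A s) A Y W - hess V A Y W| ≤ C) :
    |dAction (vary V A 1) Y W - dAction V Y W - hess V A Y W| ≤ C := by
  have h := abs_sub_le_of_abs_deriv_le (ψ := fun s => dAction (vary V A s) Y W - s * hess V A Y W)
    (ψ' := fun s => hess (vary V A s) A Y W - hess V A Y W)
    (fun s _ => by
      have h1 := hasDerivAt_dAction_vary_at₂ V A Y W s
      have h2 : HasDerivAt (fun t : ℝ => t * hess V A Y W) (hess V A Y W) s := by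
        simpa using (hasDerivAt_id s).mul_const (hess V A Y W)
      exact h1.sub h2)
    hC
  have e : dAction (vary V A 1) Y W - dAction V Y W - hess V A Y W = dAction (vary V A 1) Y W - hess V A Y W - dAction V Y W := by ring
  rw [e]
  simpa [vary_zero] using h

/-- **AT A FLAT BACKGROUND**: `V` unitary with `SmallField V 0`, `Y` skew ⟹ `|dAction (Ve^{A}) Y W − hess V A Y W| ≤ C` under the same uniform bound
(F20 `dAction_eq_zero_of_flat` removes `dAction V Y W`). [folklore] -/
theorem abs_dAction_vary_sub_hess_le_flat [Nonempty n] {V : Site d → Fin d → (Matrix n n ℂ)ˣ} (hV : IsUnitaryCfg V) (hV0 : SmallField V 0)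
    (A : Site d → Fin d → Matrix n n ℂ) {Y : Site d → Fin d → Matrix n n ℂ} (hY : IsSkewDir Y) (W : Finset (T4AveragingDeficitWall.Plaq d)) {C : ℝ}
    (hC : ∀ s ∈ Icc (0:ℝ) 1, |hess (vary V A s) A Y W - hess V A Y W| ≤ C) :
    |dAction (vary V A 1) Y W - hess V A Y W| ≤ C := by
  have h := abs_dAction_vary_sub_hess_le V A Y W hC
  rwa [dAction_eq_zero_of_flat hV hV0 hY W, sub_zero] at h

/-! ## §2 The two channels of the Hessian's variation, with the traceless channel reduced to the plaquette deviation -/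

/-- **THE TWO-CHANNEL SPLIT.**  For any backgrounds `V₁, V₀` (typically `V₁ = Ve^{sA}`, `V₀ = V`):
`hessPlaqAt V₁ X Y − hessPlaqAt V₀ X Y = −(Re tr[dcurlAt₁·(hol₁ − 1)] − Re tr[dcurlAt₀·(hol₀ − 1)]) − (Re tr[(d₁Y)(d₁X)hol₁] − Re tr[(d₀Y)(d₀X)hol₀])` —
the traceless `dcurlAt` channel only sees the plaquette deviations `hol − 1` (`nReTr_dcurlAt` at BOTH backgrounds). [folklore] -/
theorem hessPlaqAt_sub_hessPlaqAt_eq (V₁ V₀ : Site d → Fin d → (Matrix n n ℂ)ˣ) (X Y : Site d → Fin d → Matrix n n ℂ) (z : Site d) (μ ν : Fin d) :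
    hessPlaqAt V₁ X Y z μ ν - hessPlaqAt V₀ X Y z μ ν
      = -(nReTr (dcurlAt V₁ X Y z μ ν * (((hol V₁ z (plaqWord μ ν) : (Matrix n n ℂ)ˣ) : Matrix n n ℂ) - 1))
          - nReTr (dcurlAt V₀ X Y z μ ν * (((hol V₀ z (plaqWord μ ν) : (Matrix n n ℂ)ˣ) : Matrix n n ℂ) - 1)))
        - (nReTr (curlAt V₁ Y z μ ν * curlAt V₁ X z μ ν * ((hol V₁ z (plaqWord μ ν) : (Matrix n n ℂ)ˣ) : Matrix n n ℂ))
          - nReTr (curlAt V₀ Y z μ ν * curlAt V₀ X z μ ν * ((hol V₀ z (plaqWord μ ν) : (Matrix n n ℂ)ˣ) : Matrix n n ℂ))) := by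
  unfold hessPlaqAt
  have h1 : nReTr (dcurlAt V₁ X Y z μ ν * (((hol V₁ z (plaqWord μ ν) : (Matrix n n ℂ)ˣ) : Matrix n n ℂ) - 1))
      = nReTr (dcurlAt V₁ X Y z μ ν * ((hol V₁ z (plaqWord μ ν) : (Matrix n n ℂ)ˣ) : Matrix n n ℂ)) := by
    rw [mul_sub, mul_one, T4TiltOscillation.nReTr_sub, nReTr_dcurlAt, sub_zero]
  have h0 : nReTr (dcurlAt V₀ X Y z μ ν * (((hol V₀ z (plaqWord μ ν) : (Matrix n n ℂ)ˣ) : Matrix n n ℂ) - 1))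
      = nReTr (dcurlAt V₀ X Y z μ ν * ((hol V₀ z (plaqWord μ ν) : (Matrix n n ℂ)ˣ) : Matrix n n ℂ)) := by
    rw [mul_sub, mul_one, T4TiltOscillation.nReTr_sub, nReTr_dcurlAt, sub_zero]
  rw [h1, h0, add_mul, add_mul, T4TiltOscillation.nReTr_add, T4TiltOscillation.nReTr_add]
  ring

/-- **AT A FLAT `V₀`** (`hol₀ = 1`): `hessPlaqAt V₁ X Y − hessPlaqAt V₀ X Y = −Re tr[dcurlAt₁·(hol₁ − 1)] − (Re tr[(d₁Y)(d₁X)hol₁] − Re tr[(d₀Y)(d₀X)])`.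
[folklore] -/
theorem hessPlaqAt_sub_flat_eq {V₀ : Site d → Fin d → (Matrix n n ℂ)ˣ} (hV0 : SmallField V₀ 0) (V₁ : Site d → Fin d → (Matrix n n ℂ)ˣ)
    (X Y : Site d → Fin d → Matrix n n ℂ) (z : Site d) {μ ν : Fin d} (hμν : μ ≠ ν) :
    hessPlaqAt V₁ X Y z μ ν - hessPlaqAt V₀ X Y z μ ν
      = -nReTr (dcurlAt V₁ X Y z μ ν * (((hol V₁ z (plaqWord μ ν) : (Matrix n n ℂ)ˣ) : Matrix n n ℂ) - 1))
        - (nReTr (curlAt V₁ Y z μ ν * curlAt V₁ X z μ ν * ((hol V₁ z (plaqWord μ ν) : (Matrix n n ℂ)ˣ) : Matrix n n ℂ))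
          - nReTr (curlAt V₀ Y z μ ν * curlAt V₀ X z μ ν)) := by
  have h1 : ((hol V₀ z (plaqWord μ ν) : (Matrix n n ℂ)ˣ) : Matrix n n ℂ) = 1 := by
    have h := hV0 z μ ν hμν
    have : ‖((hol V₀ z (plaqWord μ ν) : (Matrix n n ℂ)ˣ) : Matrix n n ℂ) - 1‖ = 0 := le_antisymm h (norm_nonneg _)
    exact sub_eq_zero.mp (norm_eq_zero.mp this)
  rw [hessPlaqAt_sub_hessPlaqAt_eq, h1, sub_self, mul_zero, mul_one]
  simp [nReTr]

end

end Summit.QuantumFields.BalabanUV.T4Continuum.NE7ExpansionStructure
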